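import Mathlib
import Summits.ValiantsHypothesis.ValiantsHypothesis.Theorems.RigidityForcesSymmetryRankRigidMinimalReprLaplaceFiveStarLemmaKSquareMember

/-!
# ValiantsHypothesis / RigidityForcesSymmetry — crux `LaplaceOptimalFive` (stmt-ValiantsHypothesis-24813), crux idea
`young-shadow` (K1) on the star: **LEMMA K, CASE (b) ASSEMBLED — A SQUARE MEMBER FORCES `K ∈ L·⟨Q₁, Q₂⟩` OR A BINARY PENCIL**
(referee note `NOTE-crit3g5-24813-Lemma2prime-elementary.md` §B (b); memo `NOTE-p4g15-24813-K1-star.md` §14 (b))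

From the full hypothesis of LEMMA K — all `3 × 3` minors of `[∂K | ∂Q₁ | ∂Q₂]` vanish — and a SQUARE member `s U₁ + t U₂ = λλᵀ`,
`(s,t) ≠ 0`, of the pencil of two independent symmetric quadrics: reduce to the pencil basis `(L², Q'')` (`Q'' = Q₂` if `s ≠ 0`, else
`Q₁`), divide the minors by `2L` (`reduced_minors_of_square_member`), and apply ✓ `cubic_of_square_member_nondeg` /
✓ `binary_of_square_member_deg`:

★ `cubic_of_square_member` — EITHER `K = L · (C c₁ Q₁ + C c₂ Q₂)` (`K ∈ L·⟨Q₁,Q₂⟩ = ⟨L³, L Q''⟩`, the T1 shape), OR every column of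
`U₁, U₂` lies in a plane `⟨λ, f⟩` (BINARY pencil, the T2 shape).

Pure algebra; no star hypotheses, no definitions, no `sorry`.  Honest framing: helper toward the Lean price (L2) of the K1-on-the-star
theorem (PAPER, referee PASS; not kernel); `LaplaceOptimalFive` OPEN · CONTESTED 72/120; `VP ≠ VNP` NOT proved.
-/

set_option linter.dupNamespace false

namespace Summit.ValiantsHypothesis.ValiantsHypothesis.Theorems.RigidityForcesSymmetryRankRigidMinimalRepr

namespace LaplaceFiveStar

open Finset MvPolynomial

/-- The square member as a polynomial: `(Σ λ_z X_z)² = C s · Q₁ + C t · Q₂` when `s U₁ + t U₂ = λλᵀ`. [folklore] -/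
theorem sq_linForm_eq_member (U₁ U₂ : Fin 5 → Fin 5 → ℂ) (Q₁ Q₂ : MvPolynomial (Fin 5) ℂ)
    (hQ₁ : Q₁ = ∑ a : Fin 5, ∑ b : Fin 5, C (U₁ a b) * X a * X b)
    (hQ₂ : Q₂ = ∑ a : Fin 5, ∑ b : Fin 5, C (U₂ a b) * X a * X b)
    (lam : Fin 5 → ℂ) (s t : ℂ) (hsq : ∀ x w : Fin 5, s * U₁ x w + t * U₂ x w = lam x * lam w) :
    (∑ z : Fin 5, lam z • (X z : MvPolynomial (Fin 5) ℂ)) ^ 2 = C s * Q₁ + C t * Q₂ := by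
  rw [sq, Finset.sum_mul_sum, hQ₁, hQ₂, Finset.mul_sum, Finset.mul_sum, ← Finset.sum_add_distrib]
  refine Finset.sum_congr rfl fun a _ => ?_
  rw [Finset.mul_sum, Finset.mul_sum, ← Finset.sum_add_distrib]
  refine Finset.sum_congr rfl fun b _ => ?_
  rw [smul_eq_C_mul, smul_eq_C_mul]
  have hC := congr_arg (C : ℂ → MvPolynomial (Fin 5) ℂ) (hsq a b)
  simp only [map_add, map_mul] at hC
  linear_combination -(X a * X b) * hC

/-- Gradient of the square member: `C s ∂_b Q₁ + C t ∂_b Q₂ = 2 C(λ_b) · L`. [folklore] -/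
theorem pderiv_member_eq (U₁ U₂ : Fin 5 → Fin 5 → ℂ)
    (hU1 : ∀ a b : Fin 5, U₁ a b = U₁ b a) (hU2 : ∀ a b : Fin 5, U₂ a b = U₂ b a)
    (Q₁ Q₂ : MvPolynomial (Fin 5) ℂ)
    (hQ₁ : Q₁ = ∑ a : Fin 5, ∑ b : Fin 5, C (U₁ a b) * X a * X b)
    (hQ₂ : Q₂ = ∑ a : Fin 5, ∑ b : Fin 5, C (U₂ a b) * X a * X b)
    (lam : Fin 5 → ℂ) (s t : ℂ) (hsq : ∀ x w : Fin 5, s * U₁ x w + t * U₂ x w = lam x * lam w) (b : Fin 5) :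
    C s * pderiv b Q₁ + C t * pderiv b Q₂ = 2 * (C (lam b) * ∑ z : Fin 5, lam z • (X z : MvPolynomial (Fin 5) ℂ)) := by
  rw [hQ₁, hQ₂, pderiv_quadric, pderiv_quadric, Finset.mul_sum, Finset.mul_sum, ← Finset.sum_add_distrib, Finset.mul_sum,
    Finset.mul_sum]
  refine Finset.sum_congr rfl fun d _ => ?_
  rw [hU1 d b, hU2 d b, smul_eq_C_mul]
  have hC := congr_arg (C : ℂ → MvPolynomial (Fin 5) ℂ) (hsq b d)
  simp only [map_add, map_mul] at hC ⊢
  linear_combination 2 * X d * hC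

/-- **Reduced minors.**  If all minors of `[∂K | ∂Q₁ | ∂Q₂]` vanish and `C s ∂Q₁ + C t ∂Q₂ = 2 C(λ) L` with `L ≠ 0`, then the minors
of `[∂K | C∘λ | ∂Q'']` vanish for `Q'' = Q₂` when `s ≠ 0` and for `Q'' = Q₁` when `t ≠ 0` (column operations, cancelling `2L`). [folklore] -/
theorem reduced_minors_of_square_member (k p q : Fin 5 → MvPolynomial (Fin 5) ℂ) (lam : Fin 5 → ℂ)
    (L : MvPolynomial (Fin 5) ℂ) (hL0 : L ≠ 0) (s t : ℂ)
    (hP' : ∀ b : Fin 5, C s * p b + C t * q b = 2 * (C (lam b) * L))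
    (hT : ∀ a b c : Fin 5, k a * (p b * q c - p c * q b) - k b * (p a * q c - p c * q a) + k c * (p a * q b - p b * q a) = 0)
    (a b c : Fin 5) :
    (s ≠ 0 → k a * (C (lam b) * q c - C (lam c) * q b) - k b * (C (lam a) * q c - C (lam c) * q a)
      + k c * (C (lam a) * q b - C (lam b) * q a) = 0) ∧
    (t ≠ 0 → k a * (C (lam b) * p c - C (lam c) * p b) - k b * (C (lam a) * p c - C (lam c) * p a)
      + k c * (C (lam a) * p b - C (lam b) * p a) = 0) := by
  have two0 : (2 : MvPolynomial (Fin 5) ℂ) ≠ 0 := by exact_mod_cast (by norm_num : (2 : ℕ) ≠ 0)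
  constructor
  · intro _
    have key : 2 * L * (k a * (C (lam b) * q c - C (lam c) * q b) - k b * (C (lam a) * q c - C (lam c) * q a)
        + k c * (C (lam a) * q b - C (lam b) * q a)) = C s * 0 := by
      rw [← hT a b c]
      linear_combination (k b * q c - k c * q b) * hP' a - (k a * q c - k c * q a) * hP' b
        + (k a * q b - k b * q a) * hP' c
    rw [mul_zero] at key
    exact (mul_eq_zero.mp key).resolve_left (mul_ne_zero two0 hL0)
  · intro _
    have key : 2 * L * (k a * (C (lam b) * p c - C (lam c) * p b) - k b * (C (lam a) * p c - C (lam c) * p a)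
        + k c * (C (lam a) * p b - C (lam b) * p a)) = - C t * 0 := by
      rw [← hT a b c]
      linear_combination (k b * p c - k c * p b) * hP' a - (k a * p c - k c * p a) * hP' b
        + (k a * p b - k b * p a) * hP' c
    rw [mul_zero] at key
    exact (mul_eq_zero.mp key).resolve_left (mul_ne_zero two0 hL0)

/-- **LEMMA K, case (b): square member.**  Two independent symmetric quadrics `Q₁, Q₂`, a cubic form `K` with all `3 × 3` minors of
`[∂K | ∂Q₁ | ∂Q₂]` zero, and a square member `s U₁ + t U₂ = λλᵀ`, `(s,t) ≠ 0`.  Then EITHER `K = L·(C c₁ Q₁ + C c₂ Q₂)` with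
`L = Σ λ_z X_z` (T1 shape), OR all columns of `U₁, U₂` lie in a plane `⟨λ, f⟩` (binary, T2 shape). [folklore] -/
theorem cubic_of_square_member (U₁ U₂ : Fin 5 → Fin 5 → ℂ)
    (hU1 : ∀ a b : Fin 5, U₁ a b = U₁ b a) (hU2 : ∀ a b : Fin 5, U₂ a b = U₂ b a)
    (hind : ∀ s t : ℂ, (∀ x w : Fin 5, s * U₁ x w + t * U₂ x w = 0) → s = 0 ∧ t = 0)
    (Q₁ Q₂ K : MvPolynomial (Fin 5) ℂ)
    (hQ₁ : Q₁ = ∑ a : Fin 5, ∑ b : Fin 5, C (U₁ a b) * X a * X b)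
    (hQ₂ : Q₂ = ∑ a : Fin 5, ∑ b : Fin 5, C (U₂ a b) * X a * X b)
    (hK3 : K.IsHomogeneous 3)
    (hT : ∀ a b c : Fin 5,
      pderiv a K * (pderiv b Q₁ * pderiv c Q₂ - pderiv c Q₁ * pderiv b Q₂)
        - pderiv b K * (pderiv a Q₁ * pderiv c Q₂ - pderiv c Q₁ * pderiv a Q₂)
        + pderiv c K * (pderiv a Q₁ * pderiv b Q₂ - pderiv b Q₁ * pderiv a Q₂) = 0)
    (lam : Fin 5 → ℂ) (s t : ℂ) (hst : s ≠ 0 ∨ t ≠ 0) (hsq : ∀ x w : Fin 5, s * U₁ x w + t * U₂ x w = lam x * lam w) :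
    (∃ c₁ c₂ : ℂ, K = (∑ z : Fin 5, lam z • (X z : MvPolynomial (Fin 5) ℂ)) * (C c₁ * Q₁ + C c₂ * Q₂)) ∨
    (∃ e f : Fin 5 → ℂ, ∀ d : Fin 5,
      (∃ s t : ℂ, ∀ x : Fin 5, U₁ x d = s * e x + t * f x) ∧ (∃ s t : ℂ, ∀ x : Fin 5, U₂ x d = s * e x + t * f x)) := by
  classical
  -- `λ ≠ 0`
  obtain ⟨z₀, hz₀⟩ : ∃ z₀ : Fin 5, lam z₀ ≠ 0 := by
    by_contra h
    simp only [not_exists, not_not] at h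
    obtain ⟨hs, ht⟩ := hind s t fun x w => by rw [hsq x w, h x, zero_mul]
    rcases hst with h' | h'
    · exact h' hs
    · exact h' ht
  set L : MvPolynomial (Fin 5) ℂ := ∑ z : Fin 5, lam z • (X z : MvPolynomial (Fin 5) ℂ) with hL
  have hL0 : L ≠ 0 := by
    intro h
    have := (Literature.RingTheory.MvPolynomial.sum_smul_X_eq_zero_iff lam).mp h
    exact hz₀ (by rw [this]; rfl)
  have hLsq : L ^ 2 = C s * Q₁ + C t * Q₂ := sq_linForm_eq_member U₁ U₂ Q₁ Q₂ hQ₁ hQ₂ lam s t hsq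
  have hP' : ∀ b : Fin 5, C s * pderiv b Q₁ + C t * pderiv b Q₂ = 2 * (C (lam b) * L) :=
    fun b => pderiv_member_eq U₁ U₂ hU1 hU2 Q₁ Q₂ hQ₁ hQ₂ lam s t hsq b
  have hred := fun a b c => reduced_minors_of_square_member (fun a => pderiv a K) (fun a => pderiv a Q₁)
    (fun a => pderiv a Q₂) lam L hL0 s t hP' hT a b c
  by_cases hs : s ≠ 0
  · -- second generator `Q₂`
    have hT' : ∀ a b c : Fin 5, pderiv a K * (C (lam b) * pderiv c Q₂ - C (lam c) * pderiv b Q₂)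
        - pderiv b K * (C (lam a) * pderiv c Q₂ - C (lam c) * pderiv a Q₂)
        + pderiv c K * (C (lam a) * pderiv b Q₂ - C (lam b) * pderiv a Q₂) = 0 := fun a b c => (hred a b c).1 hs
    by_cases hdeg : ∀ x₁ x₂ i j : Fin 5,
        (lam z₀ * U₂ x₁ i - lam x₁ * U₂ z₀ i) * (lam z₀ * U₂ x₂ j - lam x₂ * U₂ z₀ j)
          = (lam z₀ * U₂ x₁ j - lam x₁ * U₂ z₀ j) * (lam z₀ * U₂ x₂ i - lam x₂ * U₂ z₀ i)
    · obtain ⟨f, hf⟩ := binary_of_square_member_deg lam z₀ hz₀ U₂ hU2 hdeg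
      refine Or.inr ⟨lam, f, fun d => ⟨?_, hf d⟩⟩
      obtain ⟨s₂, t₂, h₂⟩ := hf d
      refine ⟨(lam d - t * s₂) / s, -(t * t₂) / s, fun x => ?_⟩
      rw [div_mul_eq_mul_div, div_mul_eq_mul_div, ← add_div, eq_div_iff hs]
      linear_combination hsq x d - t * h₂ x
    · simp only [not_forall] at hdeg
      obtain ⟨x₁, x₂, i, j, hν⟩ := hdeg
      obtain ⟨β, c, hK⟩ := cubic_of_square_member_nondeg lam z₀ hz₀ U₂ hU2 Q₂ K hQ₂ hK3 hT' x₁ x₂ i j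
        (sub_ne_zero.mpr hν)
      refine Or.inl ⟨c * s, β + c * t, ?_⟩
      rw [hK, ← hL]
      simp only [map_add, map_mul]
      linear_combination (C c * L) * hLsq
  · have hs0 : s = 0 := by
      by_contra h
      exact hs h
    have ht : t ≠ 0 := hst.resolve_left (fun h => h hs0)
    -- second generator `Q₁`
    have hT' : ∀ a b c : Fin 5, pderiv a K * (C (lam b) * pderiv c Q₁ - C (lam c) * pderiv b Q₁)
        - pderiv b K * (C (lam a) * pderiv c Q₁ - C (lam c) * pderiv a Q₁)
        + pderiv c K * (C (lam a) * pderiv b Q₁ - C (lam b) * pderiv a Q₁) = 0 := fun a b c => (hred a b c).2 ht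
    by_cases hdeg : ∀ x₁ x₂ i j : Fin 5,
        (lam z₀ * U₁ x₁ i - lam x₁ * U₁ z₀ i) * (lam z₀ * U₁ x₂ j - lam x₂ * U₁ z₀ j)
          = (lam z₀ * U₁ x₁ j - lam x₁ * U₁ z₀ j) * (lam z₀ * U₁ x₂ i - lam x₂ * U₁ z₀ i)
    · obtain ⟨f, hf⟩ := binary_of_square_member_deg lam z₀ hz₀ U₁ hU1 hdeg
      refine Or.inr ⟨lam, f, fun d => ⟨hf d, ?_⟩⟩
      refine ⟨lam d / t, 0, fun x => ?_⟩
      rw [zero_mul, add_zero, div_mul_eq_mul_div, eq_div_iff ht]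
      have h := hsq x d
      rw [hs0, zero_mul, zero_add] at h
      linear_combination h
    · simp only [not_forall] at hdeg
      obtain ⟨x₁, x₂, i, j, hν⟩ := hdeg
      obtain ⟨β, c, hK⟩ := cubic_of_square_member_nondeg lam z₀ hz₀ U₁ hU1 Q₁ K hQ₁ hK3 hT' x₁ x₂ i j
        (sub_ne_zero.mpr hν)
      refine Or.inl ⟨β + c * s, c * t, ?_⟩
      rw [hK, ← hL]
      simp only [map_add, map_mul]
      linear_combination (C c * L) * hLsq

end LaplaceFiveStar

end Summit.ValiantsHypothesis.ValiantsHypothesis.Theorems.RigidityForcesSymmetryRankRigidMinimalRepr
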